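import Summits.Ventures.PercRepro.RankLevelSetLevelEightQuart
import Summits.Ventures.PercRepro.RankLevelSetCoreEightLargeCorank
import Summits.Ventures.PercRepro.S2GiantExactCount

/-!
# PercRepro — THE `e`-FREE CORE AT LEVEL `8` FROM A NUMERIC FORM, ON THE GIANT-EXACT COUNT, AND FROM THE LARGE-CORANK
INEQUALITY (p2, gen 35; a feeder for S4 — the top of the `q = 8` window, from `145`)

* **`c025_core_eight_of_form_gx`** — p2 g34's `c025_core_eight_bounded_corank_quart` (RankLevelSetLevelEightQuart) with the
  count `S2.ncard_eRk_eq_ncard_le_le_giant_quart'` replaced by p8 g18's giant-exact count `S2.ncard_eRk_eq_ncard_le_le_giant_exact`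
  (S2GiantExactCount) and the numeric form of the cell taken as a HYPOTHESIS (the level-`8` twin of p8's
  `c025_core_seven_of_form_gx`): the rank-`8` sets inside the unique giant flat are counted by its powerset `2^{min 159 (8 + d)}`
  instead of the pair count with the quartic weight — at `(144, 171)` the old giant term is most of the cell's budget. The
  `N`-side of the form reads `c₁·(C(n, 8) + σ_m·Π_E + 2^{min 159 (8 + d)}) ≤ c₂·2^{d−8}·C(p + 8, 8)`; the tail is unchanged.
* **`c025_core_eight_large_of_ineq`** — p2 g34's `c025_core_eight_large_corank` (RankLevelSetCoreEightLargeCorank) with the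
  large-corank inequality `largeEight_all` taken as a HYPOTHESIS (the level-`8` twin of p8's `c025_core_seven_large_of_ineq`).
Axioms: standard.
-/

set_option exponentiation.threshold 1024

open scoped Matroid

namespace PercRepro

namespace ThmN

open Set

variable {α : Type}

/-- **The `e`-free core at level `8` from a numeric form ON THE GIANT-EXACT COUNT**: the form `(c₁, c₂)` of the cell `(p, d)`
is the `N`-side `c₁·(C(n, 8) + σ_m·Π_E + 2^{min 159 (8+d)}) ≤ c₂·2^{d−8}·C(p+8, 8)` and the exact `Y`-tail, taken as a
HYPOTHESIS; the partition count with the quartic multiplicity on the non-giant sets, the powerset of the giant flat, the nullity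
cap, `f(8) ≤ 159`, `f(7) ≤ 79`, Lemmas T and T4 as in `c025_core_eight_bounded_corank_quart`. -/
theorem c025_core_eight_of_form_gx (M : Matroid α) [M.Finite] (p d : ℕ) (hd9 : 9 ≤ d)
    (hR : M.eRank = (p : ℕ∞)) (hn : M.E.ncard = p + d)
    (hfree : ∀ e ∈ M.E, ∃ A ⊆ M.E \ {e}, e ∉ M.closure A ∧ e ∉ M.closure ((M.E \ {e}) \ A))
    (hform :
      ∃ c₁ c₂ : ℕ, 0 < c₂ ∧ c₂ < c₁ ∧
      ((c₁ : ℕ) : ℚ) * ((((p + d).choose 8 : ℕ) : ℚ) + (∑ j ∈ Finset.range (d - 8), ((Nat.choose (min 150 (max ((d + min 72 d) / 2 + 1) (min 71 (d - 1) + 2) - 2)) j : ℕ) : ℚ) / (((j + 1) + 3 * (j + 1).choose 2 + 3 * (j + 1).choose 3 + 2 * (j + 1).choose 4 : ℕ) : ℚ)) *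
        (((d * (d + 1) / 2 : ℕ) : ℚ) * ((p + d).choose 6 : ℚ) + ((d * (d + 1) * (d + 2) / 3 : ℕ) : ℚ) * ((p + d).choose 5 : ℚ) + (((d + 4).choose 5 : ℕ) : ℚ) * ((p + d).choose 4 : ℚ) + (((d + 5).choose 6 : ℕ) : ℚ) * ((p + d).choose 3 : ℚ) + (((d + 6).choose 7 : ℕ) : ℚ) * ((p + d).choose 2 : ℚ) + (((d + 7).choose 8 : ℕ) : ℚ) * (p + d : ℚ) + (((d + 8).choose 9 : ℕ) : ℚ)) +
        (2 : ℚ) ^ (min 159 (8 + d))) ≤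
        ((c₂ : ℕ) : ℚ) * 2 ^ (d - 8) * (((p + 8).choose 8 : ℕ) : ℚ) ∧
        c₁ * ((p + d).choose 8 * 2 ^ (min 151 d) + (p + d).choose 7 * 2 ^ 72 + (p + d).choose 6 * 2 ^ 33 + (p + d).choose 5 * 2 ^ 14 + (p + d).choose 4 * 2 ^ 6 + (p + d).choose 3 * 2 ^ 3 + (p + d).choose 2 * 2 + (p + d) + 1 + ∑ j ∈ Finset.range (d + 1), (p + d).choose j) ≤ (c₁ - c₂) * 2 ^ (p + d)) :
    RLS M p 8 := by
  classical
  have hEcard : M.ground_finite.toFinset.card = p + d := by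
    rw [← Set.ncard_eq_toFinset_card _ M.ground_finite]; exact hn
  have hL0 : ∀ e ∈ M.E, ¬ M.IsLoop e := not_isLoop_of_free M hfree
  have hs : ∀ e ∈ M.E, ∀ f ∈ M.E, e ≠ f → M.eRk {e, f} = 2 := by
    intro e he f hf hef
    have h2 : (2 : ℕ∞) ≤ M.eRk {e, f} :=
      two_le_eRk_of_two_le_ncard_of_free M hfree (pair_subset he hf) (by rw [ncard_pair hef])
    have h3 : M.eRk {e, f} ≤ 2 := by
      have := M.eRk_le_encard {e, f}
      rwa [encard_pair hef] at this
    exact le_antisymm h3 h2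
  have hcirc : ∀ C, M.IsCircuit C → 3 ≤ C.encard := three_le_encard_of_circuit M hL0 hs
  have hd : M.E.encard = M.eRank + d := by
    rw [hR, ← M.ground_finite.cast_ncard_eq, hn]
    push_cast
    ring
  have hcap : ∀ X ⊆ M.E, ∀ k : ℕ, M.eRk X ≤ k → X.ncard ≤ k + d := by
    intro X hX k hr
    have h1 := Matroid.encard_le_eRk_add_of_encard_eq hX hd
    have h2 : X.encard ≤ (k : ℕ∞) + d := h1.trans (by gcongr)
    have hfin : X.Finite := M.ground_finite.subset hX
    rw [← hfin.cast_ncard_eq] at h2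
    exact_mod_cast h2
  -- rank-`≤ 8` sets have `≤ min 159 (8 + d)` points, rank-`≤ 7` sets `≤ min 79 (7 + d)`
  have hflat : ∀ X ⊆ M.E, M.eRk X ≤ 8 → X.ncard ≤ min 159 (8 + d) :=
    fun X hX hr => le_min (ncard_le_one_fifty_nine_of_eRk_le_eight_of_free M hfree X hX hr) (hcap X hX 8 hr)
  have hflat' : ∀ X ⊆ M.E, M.eRk X ≤ ((8 - 1 : ℕ) : ℕ∞) → X.ncard ≤ min 79 (7 + d) :=
    fun X hX hr => le_min (ncard_le_seventynine_of_eRk_le_seven_of_free M hfree X hX (by simpa using hr))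
      (hcap X hX 7 (by simpa using hr))
  have hinter := hinter_eight M hd hfree
  have hC1 : ∀ L ⊆ M.E, M.eRk L = 2 → L.ncard ≤ 3 :=
    fun L hL hr => ncard_le_three_of_eRk_two M hs hfree hL hr
  have hC1' : ∀ L ⊆ M.E, M.eRk L ≤ 2 → L.ncard ≤ 3 := by
    intro L hL' hr
    have := ncard_add_one_le_two_pow_of_eRk_le M hL0 hfree 2 L hL' hr
    omega
  have hC2 : ∀ P ⊆ M.E, M.eRk P ≤ 3 → P.ncard ≤ 6 :=
    fun P hP hr => ncard_le_six_of_eRk_le_three_of_free M hfree hP hr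
  have hs3 : {C | M.IsCircuit C ∧ C.ncard = 3}.ncard ≤ d * (d + 1) / 2 := by
    have hT : 2 * {C | M.IsCircuit C ∧ C.ncard = 3}.ncard ≤ d * (d + 1) := S1.two_mul_ncard_triangles_le M hC1 hd
    omega
  have hs4 : {C | M.IsCircuit C ∧ C.ncard = 4}.ncard ≤ d * (d + 1) * (d + 2) / 3 := by
    have hT4 : 3 * {C : Set α | M.IsCircuit C ∧ C.ncard = 4}.ncard ≤ d * (d + 1) * (d + 2) :=
      S1.three_mul_ncard_four_circuits_le M hC1' hC2 hd
    omega
  have hs5 : {C | M.IsCircuit C ∧ C.ncard = 5}.ncard ≤ (d + 4).choose 5 :=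
    Matroid.ncard_circuits_le_choose_of_encard M hd 4
  have hs6 : {C | M.IsCircuit C ∧ C.ncard = 6}.ncard ≤ (d + 5).choose 6 :=
    Matroid.ncard_circuits_le_choose_of_encard M hd 5
  have hs7 : {C | M.IsCircuit C ∧ C.ncard = 7}.ncard ≤ (d + 6).choose 7 :=
    Matroid.ncard_circuits_le_choose_of_encard M hd 6
  have hs8 : {C | M.IsCircuit C ∧ C.ncard = 8}.ncard ≤ (d + 7).choose 8 :=
    Matroid.ncard_circuits_le_choose_of_encard M hd 7
  have hs9 : {C | M.IsCircuit C ∧ C.ncard = 9}.ncard ≤ (d + 8).choose 9 :=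
    Matroid.ncard_circuits_le_choose_of_encard M hd 8
  -- (U): the giant-exact partition count with the quartic multiplicity, in `ℚ`, then the circuit bounds
  have hU0 := S2.ncard_eRk_eq_ncard_le_le_giant_exact M 8 (min 159 (8 + d)) (min 79 (7 + d))
    (max ((d + min 72 d) / 2 + 1) (min 71 (d - 1) + 2)) (min 72 d)
    (by norm_num) hcirc hC1 hC2 hflat hflat' hinter hd (by omega) (by omega)
  have hU1 := Matroid.topCount_le_ncard_compl (M := M) hR hd 8
  have hm1 : min (min 159 (8 + d) - (8 + 1)) (max ((d + min 72 d) / 2 + 1) (min 71 (d - 1) + 2) - 2) =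
      min 150 (max ((d + min 72 d) / 2 + 1) (min 71 (d - 1) + 2) - 2) := by omega
  have hm3 : min (min 159 (8 + d)) (8 + d) = min 159 (8 + d) := by omega
  rw [hn, sum_Icc_three_nine_q, hm1, hm3, show d - (8 + 1) + 1 = d - 8 by omega] at hU0
  simp only [show (8 : ℕ) + 1 = 9 from rfl, show (9 : ℕ) - 3 = 6 from rfl, show (9 : ℕ) - 4 = 5 from rfl,
    show (9 : ℕ) - 5 = 4 from rfl, show (9 : ℕ) - 6 = 3 from rfl, show (9 : ℕ) - 7 = 2 from rfl,
    show (9 : ℕ) - 8 = 1 from rfl, show (9 : ℕ) - 9 = 0 from rfl, Nat.choose_one_right,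
    Nat.choose_zero_right] at hU0
  have hUq : (Matroid.topCount M p 8 : ℚ) ≤ ((p + d).choose 8 : ℚ) +
      (∑ j ∈ Finset.range (d - 8), ((Nat.choose (min 150 (max ((d + min 72 d) / 2 + 1) (min 71 (d - 1) + 2) - 2)) j : ℕ) : ℚ) / (((j + 1) + 3 * (j + 1).choose 2 + 3 * (j + 1).choose 3 + 2 * (j + 1).choose 4 : ℕ) : ℚ)) *
        (((d * (d + 1) / 2 : ℕ) : ℚ) * ((p + d).choose 6 : ℚ) + ((d * (d + 1) * (d + 2) / 3 : ℕ) : ℚ) * ((p + d).choose 5 : ℚ) +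
          (((d + 4).choose 5 : ℕ) : ℚ) * ((p + d).choose 4 : ℚ) + (((d + 5).choose 6 : ℕ) : ℚ) * ((p + d).choose 3 : ℚ) +
          (((d + 6).choose 7 : ℕ) : ℚ) * ((p + d).choose 2 : ℚ) + (((d + 7).choose 8 : ℕ) : ℚ) * (p + d : ℚ) +
          (((d + 8).choose 9 : ℕ) : ℚ)) +
      (2 : ℚ) ^ (min 159 (8 + d)) := by
    have hU1q : (Matroid.topCount M p 8 : ℚ) ≤
        ({B : Set α | B ⊆ M.E ∧ M.eRk B = 8 ∧ B.ncard ≤ d}.ncard : ℚ) := by exact_mod_cast hU1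
    have hsm : {C | M.IsCircuit C ∧ C.ncard = 3}.ncard * (p + d).choose 6 +
        {C | M.IsCircuit C ∧ C.ncard = 4}.ncard * (p + d).choose 5 +
        {C | M.IsCircuit C ∧ C.ncard = 5}.ncard * (p + d).choose 4 +
        {C | M.IsCircuit C ∧ C.ncard = 6}.ncard * (p + d).choose 3 +
        {C | M.IsCircuit C ∧ C.ncard = 7}.ncard * (p + d).choose 2 +
        {C | M.IsCircuit C ∧ C.ncard = 8}.ncard * (p + d) + {C | M.IsCircuit C ∧ C.ncard = 9}.ncard * 1 ≤
        d * (d + 1) / 2 * (p + d).choose 6 + d * (d + 1) * (d + 2) / 3 * (p + d).choose 5 +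
          (d + 4).choose 5 * (p + d).choose 4 + (d + 5).choose 6 * (p + d).choose 3 +
          (d + 6).choose 7 * (p + d).choose 2 + (d + 7).choose 8 * (p + d) + (d + 8).choose 9 := by
      have := hs9
      gcongr
      omega
    have hsmq : (({C | M.IsCircuit C ∧ C.ncard = 3}.ncard : ℚ) * ((p + d).choose 6 : ℚ) +
        ({C | M.IsCircuit C ∧ C.ncard = 4}.ncard : ℚ) * ((p + d).choose 5 : ℚ) +
        ({C | M.IsCircuit C ∧ C.ncard = 5}.ncard : ℚ) * ((p + d).choose 4 : ℚ) +
        ({C | M.IsCircuit C ∧ C.ncard = 6}.ncard : ℚ) * ((p + d).choose 3 : ℚ) +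
        ({C | M.IsCircuit C ∧ C.ncard = 7}.ncard : ℚ) * ((p + d).choose 2 : ℚ) +
        ({C | M.IsCircuit C ∧ C.ncard = 8}.ncard : ℚ) * ((p + d : ℕ) : ℚ) +
        ({C | M.IsCircuit C ∧ C.ncard = 9}.ncard : ℚ) * ((1 : ℕ) : ℚ)) ≤
        ((d * (d + 1) / 2 * (p + d).choose 6 + d * (d + 1) * (d + 2) / 3 * (p + d).choose 5 +
          (d + 4).choose 5 * (p + d).choose 4 + (d + 5).choose 6 * (p + d).choose 3 +
          (d + 6).choose 7 * (p + d).choose 2 + (d + 7).choose 8 * (p + d) + (d + 8).choose 9 : ℕ) : ℚ) := by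
      exact_mod_cast hsm
    have hσm0 : (0 : ℚ) ≤ ∑ j ∈ Finset.range (d - 8), ((Nat.choose (min 150 (max ((d + min 72 d) / 2 + 1) (min 71 (d - 1) + 2) - 2)) j : ℕ) : ℚ) / (((j + 1) + 3 * (j + 1).choose 2 + 3 * (j + 1).choose 3 + 2 * (j + 1).choose 4 : ℕ) : ℚ) :=
      Finset.sum_nonneg (fun j _ => by positivity)
    refine hU1q.trans (hU0.trans ?_)
    have e1 := mul_le_mul_of_nonneg_left hsmq hσm0
    push_cast at e1 ⊢
    linarith
  -- (Y): the rank-`≤ 8` sets through their closures; the spanning sets by the `5/2` tail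
  have hY := Matroid.two_pow_le_midCount_add (M := M) p 8 hR
  have hsum8 := S2.ncard_eRk_le_le_sum M 8
  simp only [Finset.sum_range_succ, Finset.sum_range_zero, zero_add] at hsum8
  have hB := Matroid.ncard_spanning_le (M := M) hd
  rw [hEcard] at hY hB
  obtain ⟨c₁, c₂, hc₂, hc₁₂, hpolyq, hT⟩ := hform
  have hAB : c₁ * ({X : Set α | X ⊆ M.E ∧ M.eRk X ≤ 8}.ncard +
      {X : Set α | X ⊆ M.E ∧ M.eRk X = M.eRank}.ncard) ≤ (c₁ - c₂) * 2 ^ (p + d) := by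
    have h8 : {X : Set α | X ⊆ M.E ∧ M.eRk X = (8 : ℕ)}.ncard ≤ M.E.ncard.choose 8 * 2 ^ (min 151 d) := by
      have := S2.ncard_eRk_eq_le_choose_mul_two_pow M 8 (min 159 (8 + d))
        (fun X hX hr => hflat X hX (by exact_mod_cast hr))
      rwa [show min 159 (8 + d) - 8 = min 151 d by omega] at this
    have h7 : {X : Set α | X ⊆ M.E ∧ M.eRk X = (7 : ℕ)}.ncard ≤ M.E.ncard.choose 7 * 2 ^ (79 - 7) :=
      S2.ncard_eRk_eq_le_choose_mul_two_pow M 7 79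
        (fun X hX hr => ncard_le_seventynine_of_eRk_le_seven_of_free M hfree X hX (by exact_mod_cast hr))
    have h6 : {X : Set α | X ⊆ M.E ∧ M.eRk X = (6 : ℕ)}.ncard ≤ M.E.ncard.choose 6 * 2 ^ (39 - 6) :=
      S2.ncard_eRk_eq_le_choose_mul_two_pow M 6 39
        (fun X hX hr => ncard_le_thirtynine_of_eRk_le_six_of_free M hfree hX (by exact_mod_cast hr))
    have h5 : {X : Set α | X ⊆ M.E ∧ M.eRk X = (5 : ℕ)}.ncard ≤ M.E.ncard.choose 5 * 2 ^ (19 - 5) :=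
      S2.ncard_eRk_eq_le_choose_mul_two_pow M 5 19
        (fun X hX hr => ncard_le_nineteen_of_eRk_le_five_of_free M hfree hX (by exact_mod_cast hr))
    have h4 : {X : Set α | X ⊆ M.E ∧ M.eRk X = (4 : ℕ)}.ncard ≤ M.E.ncard.choose 4 * 2 ^ (10 - 4) :=
      S2.ncard_eRk_eq_le_choose_mul_two_pow M 4 10
        (fun X hX hr => ncard_le_ten_of_eRk_le_four_of_free M hfree hX (by exact_mod_cast hr))
    have h3 : {X : Set α | X ⊆ M.E ∧ M.eRk X = (3 : ℕ)}.ncard ≤ M.E.ncard.choose 3 * 2 ^ (6 - 3) :=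
      S2.ncard_eRk_eq_le_choose_mul_two_pow M 3 6
        (fun X hX hr => ncard_le_six_of_eRk_le_three_of_free M hfree hX (by exact_mod_cast hr))
    have h2 : {X : Set α | X ⊆ M.E ∧ M.eRk X = (2 : ℕ)}.ncard ≤ M.E.ncard.choose 2 * 2 ^ (3 - 2) :=
      S2.ncard_eRk_eq_le_choose_mul_two_pow M 2 3
        (fun X hX hr => by
          have := ncard_add_one_le_two_pow_of_eRk_le M hL0 hfree 2 X hX hr
          omega)
    have h1 : {X : Set α | X ⊆ M.E ∧ M.eRk X = (1 : ℕ)}.ncard ≤ M.E.ncard.choose 1 * 2 ^ (1 - 1) :=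
      S2.ncard_eRk_eq_le_choose_mul_two_pow M 1 1
        (fun X hX hr => by
          have := ncard_add_one_le_two_pow_of_eRk_le M hL0 hfree 1 X hX hr
          omega)
    have h0 : {X : Set α | X ⊆ M.E ∧ M.eRk X = (0 : ℕ)}.ncard ≤ M.E.ncard.choose 0 * 2 ^ (0 - 0) :=
      S2.ncard_eRk_eq_le_choose_mul_two_pow M 0 0
        (fun X hX hr => by
          have := ncard_add_one_le_two_pow_of_eRk_le M hL0 hfree 0 X hX hr
          omega)
    simp only [Nat.choose_one_right, Nat.choose_zero_right, Nat.sub_self, pow_zero, mul_one] at h1 h0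
    rw [hn] at h8 h7 h6 h5 h4 h3 h2 h1
    push_cast at hsum8 h8 h7 h6 h5 h4 h3 h2 h1 h0
    have hA : {X : Set α | X ⊆ M.E ∧ M.eRk X ≤ 8}.ncard ≤
        (p + d).choose 8 * 2 ^ (min 151 d) + (p + d).choose 7 * 2 ^ 72 + (p + d).choose 6 * 2 ^ 33 +
          (p + d).choose 5 * 2 ^ 14 + (p + d).choose 4 * 2 ^ 6 + (p + d).choose 3 * 2 ^ 3 + (p + d).choose 2 * 2 +
          (p + d) + 1 := by
      omega
    have hG : {X : Set α | X ⊆ M.E ∧ M.eRk X ≤ 8}.ncard + {X : Set α | X ⊆ M.E ∧ M.eRk X = M.eRank}.ncard ≤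
        (p + d).choose 8 * 2 ^ (min 151 d) + (p + d).choose 7 * 2 ^ 72 + (p + d).choose 6 * 2 ^ 33 +
          (p + d).choose 5 * 2 ^ 14 + (p + d).choose 4 * 2 ^ 6 + (p + d).choose 3 * 2 ^ 3 + (p + d).choose 2 * 2 +
          (p + d) + 1 + ∑ j ∈ Finset.range (d + 1), (p + d).choose j := by
      omega
    exact le_trans (Nat.mul_le_mul_left _ hG) hT
  have hΦ := phiK_le_two_pow_div p 8
  rw [Nat.choose_symm_add] at hΦ
  rw [add_assoc] at hpolyq hUq
  rw [RLS_iff]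
  have hYq : (2 : ℚ) ^ (p + d) ≤ (Matroid.midCount M p 8 : ℚ) +
      ({X : Set α | X ⊆ M.E ∧ M.eRk X ≤ 8}.ncard : ℚ) +
      ({X : Set α | X ⊆ M.E ∧ M.eRk X = M.eRank}.ncard : ℚ) := by exact_mod_cast hY
  have hABq : (c₁ : ℚ) * (({X : Set α | X ⊆ M.E ∧ M.eRk X ≤ 8}.ncard : ℚ) +
      ({X : Set α | X ⊆ M.E ∧ M.eRk X = M.eRank}.ncard : ℚ)) ≤
      ((c₁ - c₂ : ℕ) : ℚ) * 2 ^ (p + d) := by exact_mod_cast hAB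
  have hU0' : (0 : ℚ) ≤ (Matroid.topCount M p 8 : ℚ) := Nat.cast_nonneg _
  have hd8 : 8 ≤ d := by omega
  exact level_arith_form (p := p) (d := d) (n := p + d) (q := 8) rfl hd8 hc₂ hc₁₂ hΦ hU0' hUq hYq hABq hpolyq

/-- **The `e`-free core at level `8` from the large-corank inequality** (the statement of p2 g34's
`c025_core_eight_large_corank` with `largeEight_all` as a HYPOTHESIS): `Φ·#U ≤ #Y` — `#U ≤ C(n, 8)·2^151` (the flat bound
`159`), `#Y ≥ Σ_{8 ≤ k ≤ p−1} C(n, k) − #{r ≤ 8}`, `#{r ≤ 8} ≤ R₈(n)`, `Φ ≤ 2^{p+8}/C(p+8, 8)`. -/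
theorem c025_core_eight_large_of_ineq (M : Matroid α) [M.Finite] (p : ℕ) (hR : M.eRank = (p : ℕ∞))
    (hineq : (2 : ℚ) ^ (p + 159) * (M.E.ncard.choose 8 : ℚ) / ((p + 8).choose 8 : ℚ) +
      ((M.E.ncard.choose 8 * 2 ^ 151 + M.E.ncard.choose 7 * 2 ^ 72 + M.E.ncard.choose 6 * 2 ^ 33 + M.E.ncard.choose 5 * 2 ^ 14 +
        M.E.ncard.choose 4 * 2 ^ 6 + M.E.ncard.choose 3 * 2 ^ 3 + M.E.ncard.choose 2 * 2 + M.E.ncard + 1 : ℕ) : ℚ) ≤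
      ((∑ k ∈ Finset.Ico 8 p, M.E.ncard.choose k : ℕ) : ℚ))
    (hfree : ∀ e ∈ M.E, ∃ A ⊆ M.E \ {e}, e ∉ M.closure A ∧ e ∉ M.closure ((M.E \ {e}) \ A)) :
    RLS M p 8 := by
  classical
  set n := M.E.ncard with hn_def
  set d := n - p with hd_def
  have hnd : n = p + d := by
    have := M.eRank_le_encard_ground
    rw [hR, ← M.ground_finite.cast_ncard_eq] at this
    have hpn : p ≤ n := by exact_mod_cast this
    omega
  have hEcard : M.ground_finite.toFinset.card = n := by
    rw [hn_def, Set.ncard_eq_toFinset_card _ M.ground_finite]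
  have hencard : M.E.encard = M.eRank + d := by
    rw [hR, ← M.ground_finite.cast_ncard_eq, ← hn_def, hnd]
    push_cast
    ring
  have hL0 : ∀ e ∈ M.E, ¬ M.IsLoop e := not_isLoop_of_free M hfree
  -- (U): the rank-`8` sets through the flat bound `159`
  have hflat : ∀ X ⊆ M.E, M.eRk X ≤ 8 → X.ncard ≤ 159 :=
    fun X hX hr => ncard_le_one_fifty_nine_of_eRk_le_eight_of_free M hfree X hX hr
  have hU : Matroid.topCount M p 8 ≤ n.choose 8 * 2 ^ 151 := by
    calc Matroid.topCount M p 8 ≤ Matroid.levelCount M 8 := Matroid.topCount_le_levelCount_bot p 8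
      _ = {X : Set α | X ⊆ M.E ∧ M.eRk X = (8 : ℕ)}.ncard := rfl
      _ ≤ n.choose 8 * 2 ^ (159 - 8) := by
          rw [← hEcard]; exact ncard_eRk_eq_le_choose_mul_of_bound M 8 159 hflat
  -- (A): the rank-`≤ 8` sets through the flat bounds
  have hsum8 := S2.ncard_eRk_le_le_sum M 8
  simp only [Finset.sum_range_succ, Finset.sum_range_zero, zero_add] at hsum8
  have h8 : {X : Set α | X ⊆ M.E ∧ M.eRk X = (8 : ℕ)}.ncard ≤ M.E.ncard.choose 8 * 2 ^ (159 - 8) :=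
    S2.ncard_eRk_eq_le_choose_mul_two_pow M 8 159 (fun X hX hr => hflat X hX (by exact_mod_cast hr))
  have h7 : {X : Set α | X ⊆ M.E ∧ M.eRk X = (7 : ℕ)}.ncard ≤ M.E.ncard.choose 7 * 2 ^ (79 - 7) :=
    S2.ncard_eRk_eq_le_choose_mul_two_pow M 7 79
      (fun X hX hr => ncard_le_seventynine_of_eRk_le_seven_of_free M hfree X hX (by exact_mod_cast hr))
  have h6 : {X : Set α | X ⊆ M.E ∧ M.eRk X = (6 : ℕ)}.ncard ≤ M.E.ncard.choose 6 * 2 ^ (39 - 6) :=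
    S2.ncard_eRk_eq_le_choose_mul_two_pow M 6 39
      (fun X hX hr => ncard_le_thirtynine_of_eRk_le_six_of_free M hfree hX (by exact_mod_cast hr))
  have h5 : {X : Set α | X ⊆ M.E ∧ M.eRk X = (5 : ℕ)}.ncard ≤ M.E.ncard.choose 5 * 2 ^ (19 - 5) :=
    S2.ncard_eRk_eq_le_choose_mul_two_pow M 5 19
      (fun X hX hr => ncard_le_nineteen_of_eRk_le_five_of_free M hfree hX (by exact_mod_cast hr))
  have h4 : {X : Set α | X ⊆ M.E ∧ M.eRk X = (4 : ℕ)}.ncard ≤ M.E.ncard.choose 4 * 2 ^ (10 - 4) :=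
    S2.ncard_eRk_eq_le_choose_mul_two_pow M 4 10
      (fun X hX hr => ncard_le_ten_of_eRk_le_four_of_free M hfree hX (by exact_mod_cast hr))
  have h3 : {X : Set α | X ⊆ M.E ∧ M.eRk X = (3 : ℕ)}.ncard ≤ M.E.ncard.choose 3 * 2 ^ (6 - 3) :=
    S2.ncard_eRk_eq_le_choose_mul_two_pow M 3 6
      (fun X hX hr => ncard_le_six_of_eRk_le_three_of_free M hfree hX (by exact_mod_cast hr))
  have h2 : {X : Set α | X ⊆ M.E ∧ M.eRk X = (2 : ℕ)}.ncard ≤ M.E.ncard.choose 2 * 2 ^ (3 - 2) :=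
    S2.ncard_eRk_eq_le_choose_mul_two_pow M 2 3
      (fun X hX hr => by
        have := ncard_add_one_le_two_pow_of_eRk_le M hL0 hfree 2 X hX hr
        omega)
  have h1 : {X : Set α | X ⊆ M.E ∧ M.eRk X = (1 : ℕ)}.ncard ≤ M.E.ncard.choose 1 * 2 ^ (1 - 1) :=
    S2.ncard_eRk_eq_le_choose_mul_two_pow M 1 1
      (fun X hX hr => by
        have := ncard_add_one_le_two_pow_of_eRk_le M hL0 hfree 1 X hX hr
        omega)
  have h0 : {X : Set α | X ⊆ M.E ∧ M.eRk X = (0 : ℕ)}.ncard ≤ M.E.ncard.choose 0 * 2 ^ (0 - 0) :=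
    S2.ncard_eRk_eq_le_choose_mul_two_pow M 0 0
      (fun X hX hr => by
        have := ncard_add_one_le_two_pow_of_eRk_le M hL0 hfree 0 X hX hr
        omega)
  simp only [Nat.choose_one_right, Nat.choose_zero_right, Nat.sub_self, pow_zero, mul_one] at h1 h0
  rw [← hn_def] at h8 h7 h6 h5 h4 h3 h2 h1
  push_cast at hsum8 h8 h7 h6 h5 h4 h3 h2 h1 h0
  have hA : {X : Set α | X ⊆ M.E ∧ M.eRk X ≤ 8}.ncard ≤
      n.choose 8 * 2 ^ 151 + n.choose 7 * 2 ^ 72 + n.choose 6 * 2 ^ 33 + n.choose 5 * 2 ^ 14 + n.choose 4 * 2 ^ 6 +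
        n.choose 3 * 2 ^ 3 + n.choose 2 * 2 + n + 1 := by
    omega
  -- (Y): `2^n ≤ Y + A + B`, `B ≤ Σ_{j ≤ d} C(n, j)`, and `Σ_{k ∈ Ico 8 p} C(n, k) + Σ_{j ≤ d} C(n, j) ≤ 2^n`
  have hY := Matroid.two_pow_le_midCount_add (M := M) p 8 hR
  have hB := Matroid.ncard_spanning_le (M := M) hencard
  rw [hEcard] at hY hB
  push_cast at hY
  have hsplit := sum_Ico_choose_add_sum_range_choose_le_eight p d
  rw [← hnd] at hsplit
  have hYge : ∑ k ∈ Finset.Ico 8 p, n.choose k ≤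
      Matroid.midCount M p 8 + {X : Set α | X ⊆ M.E ∧ M.eRk X ≤ 8}.ncard := by
    omega
  -- assemble in `ℚ`
  have hΦ := phiK_le_two_pow_div p 8
  rw [Nat.choose_symm_add] at hΦ
  rw [RLS_iff]
  have hc : (0 : ℚ) < ((p + 8).choose 8 : ℚ) := by exact_mod_cast Nat.choose_pos (by omega)
  have hU0 : (0 : ℚ) ≤ (Matroid.topCount M p 8 : ℚ) := Nat.cast_nonneg _
  have hUq : (Matroid.topCount M p 8 : ℚ) ≤ (n.choose 8 : ℚ) * 2 ^ 151 := by exact_mod_cast hU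
  have hAq : ({X : Set α | X ⊆ M.E ∧ M.eRk X ≤ 8}.ncard : ℚ) ≤
      ((n.choose 8 * 2 ^ 151 + n.choose 7 * 2 ^ 72 + n.choose 6 * 2 ^ 33 + n.choose 5 * 2 ^ 14 + n.choose 4 * 2 ^ 6 +
        n.choose 3 * 2 ^ 3 + n.choose 2 * 2 + n + 1 : ℕ) : ℚ) := by exact_mod_cast hA
  have hYq : ((∑ k ∈ Finset.Ico 8 p, n.choose k : ℕ) : ℚ) ≤
      (Matroid.midCount M p 8 : ℚ) + ({X : Set α | X ⊆ M.E ∧ M.eRk X ≤ 8}.ncard : ℚ) := by exact_mod_cast hYge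
  have hΦU : phiK p 8 * (Matroid.topCount M p 8 : ℚ) ≤
      (2 : ℚ) ^ (p + 159) * (n.choose 8 : ℚ) / ((p + 8).choose 8 : ℚ) := by
    calc phiK p 8 * (Matroid.topCount M p 8 : ℚ)
        ≤ (2 : ℚ) ^ (p + 8) / ((p + 8).choose 8 : ℚ) * ((n.choose 8 : ℚ) * 2 ^ 151) :=
          mul_le_mul hΦ hUq hU0 (by positivity)
      _ = (2 : ℚ) ^ (p + 159) * (n.choose 8 : ℚ) / ((p + 8).choose 8 : ℚ) := by
          rw [show p + 159 = p + 8 + 151 by ring, pow_add]; ring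
  calc phiK p 8 * (Matroid.topCount M p 8 : ℚ)
      ≤ (2 : ℚ) ^ (p + 159) * (n.choose 8 : ℚ) / ((p + 8).choose 8 : ℚ) := hΦU
    _ ≤ ((∑ k ∈ Finset.Ico 8 p, n.choose k : ℕ) : ℚ) -
        ((n.choose 8 * 2 ^ 151 + n.choose 7 * 2 ^ 72 + n.choose 6 * 2 ^ 33 + n.choose 5 * 2 ^ 14 + n.choose 4 * 2 ^ 6 +
          n.choose 3 * 2 ^ 3 + n.choose 2 * 2 + n + 1 : ℕ) : ℚ) := by linarith [hineq]
    _ ≤ ((∑ k ∈ Finset.Ico 8 p, n.choose k : ℕ) : ℚ) -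
        ({X : Set α | X ⊆ M.E ∧ M.eRk X ≤ 8}.ncard : ℚ) := by linarith [hAq]
    _ ≤ (Matroid.midCount M p 8 : ℚ) := by linarith [hYq]

end ThmN

end PercRepro
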